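import Mathlib

/-!
# `SnSubsetDichotomy.PolynomialSlack`, line `transport-split-hull` — stub `trichotomy_parameter_bounds`

Crux `Summit.MatrixMultiplication.MatrixMultiplication.Theses.SnSubsetDichotomy.PolynomialSlack`
(item `stmt-MatrixMultiplication-8306`), level-one programme, line transport-split-hull
(lead c10), registered stub `trichotomy_parameter_bounds`; pure real analysis, feeding
`eventually_trichotomy_ranges` (`…TrichotomyRanges`).

The 3/4 step (`pure_violator_volume_le_trichotomy`) runs with the parameter chain
`Λ = 1200 G²` (`G := 1 + log n`), `ε₂ = 1/(1000 Λ)`, `εm = ε₂² / (12 G (2 + log (1/ε₂)))`,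
`LK = 3/2 log n + 5`, `Φ₀ = 576 G (2 (log 8 + LK + log (1/εm))) / εm³`, `τ = 1/(400 Φ₀)`,
`mR = ⌊log₂ n²⌋₊ + 1`, `ε₁ = τ / (10⁵ Λ G mR)`, `h₁ = τ / (10⁴ Λ mR²)`, `M = 10⁴ Λ mR² / τ`,
`A₀ = 5000 n G (LK + log (4/ε₂)) / ε₂²`.  This file records that every one of these is
positive and polylogarithmic in `n`: with `1 ≤ mR ≤ 3 G` (the dyadic level count) one has
`1/ε₂ = 1.2·10⁶ G²`, `1/τ ≤ 10⁸⁷ G²⁹`, `1/ε₁, 1/h₁ ≤ 10⁹⁶ G³³`, `1 + M ≤ 2·10⁹⁶ G³³`,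
`0 < LK + log (4/ε₂) ≤ 10⁷ G²` and `0 < A₀ ≤ 10²³ n G⁷`.

Proof.  Only the crude inequality `log y ≤ y - 1 ≤ y` (`Real.log_le_sub_one_of_pos`) is used for
the inner logarithms, so every bound is a monomial in `G ≥ 1` with an explicit constant:
`log (1/ε₂) ≤ 1/ε₂ = 1.2·10⁶ G²`, hence `1 ≤ 1/εm = 12 G (2 + log (1/ε₂)) (1/ε₂)² ≤ 10²⁰ G⁷` and
`log (1/εm) ≤ 10²⁰ G⁷`; with `5 ≤ LK ≤ 7 G` and `0 ≤ log 8 ≤ 8` this gives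
`1 ≤ Φ₀ = 1152 G (log 8 + LK + log (1/εm)) (1/εm)³ ≤ 10⁸⁴ G²⁹`, so `1/τ = 400 Φ₀ ≤ 10⁸⁷ G²⁹`,
and the remaining bounds are products of these (`gcongr`, `ring`, `norm_num`).  The degrees and
constants are immaterial downstream: each range condition is closed by the master comparison
`eventually_log_pow_mul_rpow_le` (polylog times a power is eventually below a larger power).
-/

namespace Summit.MatrixMultiplication.MatrixMultiplication.Theorems.PolynomialSlack

-- `Summit.<Summit>.<Problem>` is the tree's mandated summit-side namespace; for this
-- single-conjunct summit the two coincide, so the file silences `dupNamespace`.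
set_option linter.dupNamespace false


/-- The scale `ε₂ = 1/(1000 Λ)`, `Λ = 1200 G²`: `1/ε₂ = 1200000 G²` and the logarithms
`log (1/ε₂)`, `log (4/ε₂)` are nonnegative and at most `1200000 G²`, `4800000 G²`. [folklore] -/
theorem trichotomyBounds_eps2 {G Λ ε₂ : ℝ} (hG : 1 ≤ G) (hΛ : Λ = 1200 * G ^ 2)
    (hε₂ : ε₂ = 1 / (1000 * Λ)) :
    0 < ε₂ ∧ 1 / ε₂ = 1200000 * G ^ 2 ∧
      0 ≤ Real.log (1 / ε₂) ∧ Real.log (1 / ε₂) ≤ 1200000 * G ^ 2 ∧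
      0 ≤ Real.log (4 / ε₂) ∧ Real.log (4 / ε₂) ≤ 4800000 * G ^ 2 := by
  have hE : 1 / ε₂ = 1200000 * G ^ 2 := by
    rw [hε₂, hΛ, one_div_one_div]
    ring
  have hpos : 0 < ε₂ := by
    rw [hε₂, hΛ]
    positivity
  have hG2 : 1 ≤ G ^ 2 := one_le_pow₀ hG
  have hE1 : 1 ≤ 1 / ε₂ := by
    rw [hE]
    linarith
  have h4 : 4 / ε₂ = 4 * (1 / ε₂) := by ring
  refine ⟨hpos, hE, Real.log_nonneg hE1, ?_, ?_, ?_⟩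
  · have := Real.log_le_sub_one_of_pos (lt_of_lt_of_le one_pos hE1)
    linarith
  · rw [h4]
    exact Real.log_nonneg (by linarith)
  · rw [h4]
    have := Real.log_le_sub_one_of_pos (by linarith : (0 : ℝ) < 4 * (1 / ε₂))
    linarith

/-- The scale `εm = ε₂² / (12 G (2 + log (1/ε₂)))`: `1 ≤ 1/εm ≤ 10^20 G⁷` and
`0 ≤ log (1/εm) ≤ 10^20 G⁷`. [folklore] -/
theorem trichotomyBounds_epsm {G ε₂ εm : ℝ} (hG : 1 ≤ G) (hε₂0 : 0 < ε₂)
    (hE : 1 / ε₂ = 1200000 * G ^ 2) (hl0 : 0 ≤ Real.log (1 / ε₂))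
    (hl : Real.log (1 / ε₂) ≤ 1200000 * G ^ 2)
    (hεm : εm = ε₂ ^ 2 / (12 * G * (2 + Real.log (1 / ε₂)))) :
    0 < εm ∧ 1 ≤ 1 / εm ∧ 1 / εm ≤ 10 ^ 20 * G ^ 7 ∧
      0 ≤ Real.log (1 / εm) ∧ Real.log (1 / εm) ≤ 10 ^ 20 * G ^ 7 := by
  have hpos : 0 < εm := by
    rw [hεm]
    positivity
  have hEm : 1 / εm = 12 * G * (2 + Real.log (1 / ε₂)) * (1 / ε₂) ^ 2 := by
    rw [hεm]
    field_simp
  have hG2 : 1 ≤ G ^ 2 := one_le_pow₀ hG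
  have hG7 : G ^ 2 ≤ G ^ 7 := pow_le_pow_right₀ hG (by norm_num)
  have hE1 : 1 ≤ 1 / ε₂ := by
    rw [hE]
    linarith
  have hEle : 1 / ε₂ ≤ 1200000 * G ^ 2 := hE.le
  have hEm1 : 1 ≤ 1 / εm := by
    rw [hEm]
    calc (1 : ℝ) ≤ 12 * 1 * (2 + 0) * 1 ^ 2 := by norm_num
      _ ≤ 12 * G * (2 + Real.log (1 / ε₂)) * (1 / ε₂) ^ 2 := by gcongr
  have hEmU : 1 / εm ≤ 10 ^ 20 * G ^ 7 := by
    rw [hEm]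
    calc 12 * G * (2 + Real.log (1 / ε₂)) * (1 / ε₂) ^ 2
        ≤ 12 * G * (2 * G ^ 2 + 1200000 * G ^ 2) * (1200000 * G ^ 2) ^ 2 := by
          gcongr
          linarith
      _ = 12 * 1200002 * 1200000 ^ 2 * G ^ 7 := by ring
      _ ≤ 10 ^ 20 * G ^ 7 := by gcongr; norm_num
  refine ⟨hpos, hEm1, hEmU, Real.log_nonneg hEm1, ?_⟩
  have := Real.log_le_sub_one_of_pos (lt_of_lt_of_le one_pos hEm1)
  linarith

/-- `LK = 3/2 log x + 5` for `x ≥ 1`: `5 ≤ LK ≤ 7 (1 + log x)`. [folklore] -/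
theorem trichotomyBounds_LK {x LK : ℝ} (hx : 1 ≤ x) (hLK : LK = 3 / 2 * Real.log x + 5) :
    5 ≤ LK ∧ LK ≤ 7 * (1 + Real.log x) := by
  have hL := Real.log_nonneg hx
  constructor <;> rw [hLK] <;> linarith

/-- The potential `Φ₀ = 576 G (2 (log 8 + LK + log (1/εm))) / εm³`: `1 ≤ Φ₀ ≤ 10^84 G^29`.
[folklore] -/
theorem trichotomyBounds_Phi {G εm LK Φ₀ : ℝ} (hG : 1 ≤ G) (hεm0 : 0 < εm) (hEm1 : 1 ≤ 1 / εm)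
    (hEm : 1 / εm ≤ 10 ^ 20 * G ^ 7) (hlm0 : 0 ≤ Real.log (1 / εm))
    (hlm : Real.log (1 / εm) ≤ 10 ^ 20 * G ^ 7) (hLK5 : 5 ≤ LK) (hLK : LK ≤ 7 * G)
    (hΦ₀ : Φ₀ = 576 * G * (2 * (Real.log 8 + LK + Real.log (1 / εm))) / εm ^ 3) :
    1 ≤ Φ₀ ∧ Φ₀ ≤ 10 ^ 84 * G ^ 29 := by
  have hΦ : Φ₀ = 576 * G * (2 * (Real.log 8 + LK + Real.log (1 / εm))) * (1 / εm) ^ 3 := by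
    rw [hΦ₀]
    field_simp
  have hl8 : 0 ≤ Real.log 8 := Real.log_nonneg (by norm_num)
  have hl8' : Real.log 8 ≤ 8 := by
    have := Real.log_le_sub_one_of_pos (by norm_num : (0 : ℝ) < 8)
    linarith
  have hG7 : G ≤ G ^ 7 := le_self_pow₀ hG (by norm_num)
  have hG71 : 1 ≤ G ^ 7 := one_le_pow₀ hG
  have hsum5 : 5 ≤ Real.log 8 + LK + Real.log (1 / εm) := by linarith
  have hsum : Real.log 8 + LK + Real.log (1 / εm) ≤ (15 + 10 ^ 20) * G ^ 7 := by nlinarith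
  have hEm3 : 1 ≤ (1 / εm) ^ 3 := one_le_pow₀ hEm1
  constructor
  · rw [hΦ]
    calc (1 : ℝ) ≤ 576 * 1 * (2 * 5) * 1 := by norm_num
      _ ≤ 576 * G * (2 * (Real.log 8 + LK + Real.log (1 / εm))) * (1 / εm) ^ 3 := by gcongr
  · rw [hΦ]
    calc 576 * G * (2 * (Real.log 8 + LK + Real.log (1 / εm))) * (1 / εm) ^ 3
        ≤ 576 * G * (2 * ((15 + 10 ^ 20) * G ^ 7)) * (10 ^ 20 * G ^ 7) ^ 3 := by gcongr
      _ = 1152 * (15 + 10 ^ 20) * 10 ^ 60 * G ^ 29 := by ring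
      _ ≤ 10 ^ 84 * G ^ 29 := by gcongr; norm_num

/-- The gain `τ = 1/(400 Φ₀)` with `1 ≤ Φ₀ ≤ 10^84 G^29`: `0 < τ` and `1/τ ≤ 10^87 G^29`.
[folklore] -/
theorem trichotomyBounds_tau {G Φ₀ τ : ℝ} (hΦ1 : 1 ≤ Φ₀) (hΦ : Φ₀ ≤ 10 ^ 84 * G ^ 29)
    (hτ : τ = 1 / (400 * Φ₀)) : 0 < τ ∧ 1 / τ ≤ 10 ^ 87 * G ^ 29 := by
  have hΦ0 : 0 < Φ₀ := by linarith
  refine ⟨by rw [hτ]; positivity, ?_⟩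
  rw [hτ, one_div_one_div]
  linarith

/-- The accuracies `ε₁ = τ / (10^5 Λ G mR)`, `h₁ = τ / (10^4 Λ mR²)` and `M = 10^4 Λ mR² / τ`
with `1 ≤ mR ≤ 3 G`: positivity and `1/ε₁, 1/h₁ ≤ 10^96 G^33`, `1 + M ≤ 2·10^96 G^33`.
[folklore] -/
theorem trichotomyBounds_eps1 {G Λ τ mR ε₁ h₁ M : ℝ} (hG : 1 ≤ G) (hΛ : Λ = 1200 * G ^ 2)
    (hτ0 : 0 < τ) (hT : 1 / τ ≤ 10 ^ 87 * G ^ 29) (hmR1 : 1 ≤ mR) (hmR : mR ≤ 3 * G)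
    (hε₁ : ε₁ = τ / (10 ^ 5 * Λ * G * mR)) (hh₁ : h₁ = τ / (10 ^ 4 * Λ * mR ^ 2))
    (hM : M = 10 ^ 4 * Λ * mR ^ 2 / τ) :
    0 < ε₁ ∧ 1 / ε₁ ≤ 10 ^ 96 * G ^ 33 ∧ 0 < h₁ ∧ 1 / h₁ ≤ 10 ^ 96 * G ^ 33 ∧
      0 ≤ M ∧ 1 + M ≤ 2 * 10 ^ 96 * G ^ 33 := by
  have hT0 : 0 ≤ 1 / τ := by positivity
  have hG33 : 1 ≤ G ^ 33 := one_le_pow₀ hG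
  have hE₁ : 1 / ε₁ = 10 ^ 5 * Λ * G * mR * (1 / τ) := by
    rw [hε₁]
    field_simp
  have hH₁ : 1 / h₁ = 10 ^ 4 * Λ * mR ^ 2 * (1 / τ) := by
    rw [hh₁]
    field_simp
  have hM' : M = 10 ^ 4 * Λ * mR ^ 2 * (1 / τ) := by
    rw [hM]
    field_simp
  have hE₁U : 1 / ε₁ ≤ 10 ^ 96 * G ^ 33 := by
    rw [hE₁, hΛ]
    calc 10 ^ 5 * (1200 * G ^ 2) * G * mR * (1 / τ)
        ≤ 10 ^ 5 * (1200 * G ^ 2) * G * (3 * G) * (10 ^ 87 * G ^ 29) := by gcongr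
      _ = 36 * 10 ^ 94 * G ^ 33 := by ring
      _ ≤ 10 ^ 96 * G ^ 33 := by gcongr; norm_num
  have hMU : 10 ^ 4 * Λ * mR ^ 2 * (1 / τ) ≤ 10 ^ 96 * G ^ 33 := by
    rw [hΛ]
    calc 10 ^ 4 * (1200 * G ^ 2) * mR ^ 2 * (1 / τ)
        ≤ 10 ^ 4 * (1200 * G ^ 2) * (3 * G) ^ 2 * (10 ^ 87 * G ^ 29) := by gcongr
      _ = 108 * 10 ^ 93 * G ^ 33 := by ring
      _ ≤ 10 ^ 96 * G ^ 33 := by gcongr; norm_num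
  have hε₁0 : 0 < ε₁ := by rw [hε₁, hΛ]; positivity
  have hh₁0 : 0 < h₁ := by rw [hh₁, hΛ]; positivity
  have hM0 : 0 ≤ M := by rw [hM, hΛ]; positivity
  refine ⟨hε₁0, hE₁U, hh₁0, hH₁ ▸ hMU, hM0, ?_⟩
  rw [hM']
  linarith

/-- The threshold `A₀ = 5000 x G (LK + log (4/ε₂)) / ε₂²`: with `S := LK + log (4/ε₂)`,
`0 < S ≤ 10^7 G²` and `0 < A₀ ≤ 10^23 x G⁷` for `x > 0`. [folklore] -/
theorem trichotomyBounds_A0 {x G ε₂ LK A₀ : ℝ} (hx : 0 < x) (hG : 1 ≤ G) (hε₂0 : 0 < ε₂)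
    (hE : 1 / ε₂ = 1200000 * G ^ 2) (hl40 : 0 ≤ Real.log (4 / ε₂))
    (hl4 : Real.log (4 / ε₂) ≤ 4800000 * G ^ 2) (hLK5 : 5 ≤ LK) (hLK : LK ≤ 7 * G)
    (hA₀ : A₀ = 5000 * x * G * (LK + Real.log (4 / ε₂)) / ε₂ ^ 2) :
    0 < LK + Real.log (4 / ε₂) ∧ LK + Real.log (4 / ε₂) ≤ 10 ^ 7 * G ^ 2 ∧
      0 < A₀ ∧ A₀ ≤ 10 ^ 23 * x * G ^ 7 := by
  have hS0 : 0 < LK + Real.log (4 / ε₂) := by linarith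
  have hGG : G ≤ G ^ 2 := le_self_pow₀ hG (by norm_num)
  have hS : LK + Real.log (4 / ε₂) ≤ 10 ^ 7 * G ^ 2 := by nlinarith
  have hA : A₀ = 5000 * x * G * (LK + Real.log (4 / ε₂)) * (1 / ε₂) ^ 2 := by
    rw [hA₀]
    field_simp
  refine ⟨hS0, hS, by rw [hA₀]; positivity, ?_⟩
  rw [hA, hE]
  calc 5000 * x * G * (LK + Real.log (4 / ε₂)) * (1200000 * G ^ 2) ^ 2
      ≤ 5000 * x * G * (10 ^ 7 * G ^ 2) * (1200000 * G ^ 2) ^ 2 := by gcongr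
    _ = 72 * 10 ^ 21 * x * G ^ 7 := by ring
    _ ≤ 10 ^ 23 * x * G ^ 7 := by gcongr; norm_num


/-- **Polylog bounds on the 3/4-step parameter chain** (registered stub
`trichotomy_parameter_bounds` of line `transport-split-hull`): at a real `x ≥ 1`, with
`G = 1 + log x` and `1 ≤ mR ≤ 3 G` in place of the dyadic level count, the defining equations of
`Λ, ε₂, εm, LK, Φ₀, τ, ε₁, h₁, M, A₀` give `0 < ε₂`, `1/ε₂ = 1200000 G²`, `0 < τ`,
`1/τ ≤ 10^87 G^29`, `0 < ε₁`, `1/ε₁ ≤ 10^96 G^33`, `0 < h₁`, `1/h₁ ≤ 10^96 G^33`, `0 ≤ M`,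
`1 + M ≤ 2·10^96 G^33`, `0 < LK + log (4/ε₂) ≤ 10^7 G²` and `0 < A₀ ≤ 10^23 x G⁷`
(the lemmas above, chained). [folklore] -/
theorem trichotomy_parameter_bounds {x Λ ε₂ εm LK Φ₀ τ mR ε₁ h₁ M A₀ : ℝ} (hx : 1 ≤ x)
    (hmR1 : 1 ≤ mR) (hmR : mR ≤ 3 * (1 + Real.log x))
    (hΛ : Λ = 1200 * (1 + Real.log x) ^ 2) (hε₂ : ε₂ = 1 / (1000 * Λ))
    (hεm : εm = ε₂ ^ 2 / (12 * (1 + Real.log x) * (2 + Real.log (1 / ε₂))))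
    (hLK : LK = 3 / 2 * Real.log x + 5)
    (hΦ₀ : Φ₀ = 576 * (1 + Real.log x) * (2 * (Real.log 8 + LK + Real.log (1 / εm))) / εm ^ 3)
    (hτ : τ = 1 / (400 * Φ₀)) (hε₁ : ε₁ = τ / (10 ^ 5 * Λ * (1 + Real.log x) * mR))
    (hh₁ : h₁ = τ / (10 ^ 4 * Λ * mR ^ 2)) (hM : M = 10 ^ 4 * Λ * mR ^ 2 / τ)
    (hA₀ : A₀ = 5000 * x * (1 + Real.log x) * (LK + Real.log (4 / ε₂)) / ε₂ ^ 2) :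
    0 < ε₂ ∧ 1 / ε₂ = 1200000 * (1 + Real.log x) ^ 2 ∧
      0 < τ ∧ 1 / τ ≤ 10 ^ 87 * (1 + Real.log x) ^ 29 ∧
      0 < ε₁ ∧ 1 / ε₁ ≤ 10 ^ 96 * (1 + Real.log x) ^ 33 ∧
      0 < h₁ ∧ 1 / h₁ ≤ 10 ^ 96 * (1 + Real.log x) ^ 33 ∧
      0 ≤ M ∧ 1 + M ≤ 2 * 10 ^ 96 * (1 + Real.log x) ^ 33 ∧
      0 < LK + Real.log (4 / ε₂) ∧ LK + Real.log (4 / ε₂) ≤ 10 ^ 7 * (1 + Real.log x) ^ 2 ∧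
      0 < A₀ ∧ A₀ ≤ 10 ^ 23 * x * (1 + Real.log x) ^ 7 := by
  have hx0 : 0 < x := lt_of_lt_of_le one_pos hx
  have hG : 1 ≤ 1 + Real.log x := by
    have := Real.log_nonneg hx
    linarith
  obtain ⟨hε₂0, hE, hl0, hl, hl40, hl4⟩ := trichotomyBounds_eps2 hG hΛ hε₂
  obtain ⟨hεm0, hEm1, hEm, hlm0, hlm⟩ := trichotomyBounds_epsm hG hε₂0 hE hl0 hl hεm
  obtain ⟨hLK5, hLK7⟩ := trichotomyBounds_LK hx hLK
  obtain ⟨hΦ1, hΦ⟩ := trichotomyBounds_Phi hG hεm0 hEm1 hEm hlm0 hlm hLK5 hLK7 hΦ₀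
  obtain ⟨hτ0, hT⟩ := trichotomyBounds_tau hΦ1 hΦ hτ
  obtain ⟨hε₁0, hE₁, hh₁0, hH, hM0, hM1⟩ :=
    trichotomyBounds_eps1 hG hΛ hτ0 hT hmR1 hmR hε₁ hh₁ hM
  obtain ⟨hS0, hS, hA0, hA⟩ := trichotomyBounds_A0 hx0 hG hε₂0 hE hl40 hl4 hLK5 hLK7 hA₀
  exact ⟨hε₂0, hE, hτ0, hT, hε₁0, hE₁, hh₁0, hH, hM0, hM1, hS0, hS, hA0, hA⟩

end Summit.MatrixMultiplication.MatrixMultiplication.Theorems.PolynomialSlack
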